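import Summits.BirchSwinnertonDyer.BirchSwinnertonDyer.Theorems.KimAtThreeFineKatoLemmaL
import Mathlib.Topology.Instances.AddCircle.Real
import Mathlib.Algebra.Category.Grp.Injective
import HarnessLib

/-!
# Lemma L, GALOIS side, UNIFORM in the row: the finite-level functionals `Λfin_j` from an abstract
# integral `exp*_ω` WITHOUT surjectivity of `π_{j+1,*}` (any local torsion `E(ℚ₃)[3]`, any reduction
# type at `3`), and the normalisation of a scalar dual exponential satisfying the lattice-form duality
# fact at EVERY reduction type — crux `DeepUpperAtThree` (stmt-BirchSwinnertonDyer-19076), route W2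
# `KimAtThreeKolyvagin` (cell `bsd-addord`, seat w2-c3 gen 7; `--supports 19076`, helper)

HONEST FRAMING. TOOL theorems only (no definition, no named fact, no `sorry`); closes nothing; nothing is
booked; BSD is not proved by any of this.  The scalar Bloch–Kato dual exponential `exp*_ω` is NOT
constructed: it is an arbitrary additive map `φ : H¹(ℚ_v, T_pW) → ℚ_p` (binder), exactly as in seat kim3
gen 13's `KimAtThreeFineKatoLemmaL` (p490100), whose §2 is imported and used BY NAME.

## What, and why

kim3's `exists_functional_tateLocalMap_eq` builds `Λ_k : H¹(ℚ_v, E[p^k·p]) →+ ℤ/p^{k+1}` with the interface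
`Λ_k(π_{k+1,*} y) = exp*_ω(y) mod p^{k+1}` ONLY when `π_{k+1,*}` is onto (`𝓕_can(v) = ⊤`, i.e. `E(ℚ₃)[3] = 0`
at `v ∣ 3` — the Kato stratum of crux 19560).  Crux 19076 is stated for EVERY tower row, so its uniform
road (this seat's gens 6–7: `KimAtThreeDeepUpperUniformOfFineKato`, `KimAtThreeDeepUpperUniformPinned`)
needs `Λ_k` on rows where `𝓕_can(v₃) ≠ ⊤`.  This file supplies it:
* §1 `exists_addMonoidHom_extend_zmod` — pure algebra: a homomorphism into `ℤ/n` defined on a subgroup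
  of an `n`-torsion abelian group extends to the whole group (`ℤ/n ↪ ℝ/ℤ` by `ZMod.toAddCircle`, `ℝ/ℤ`
  is divisible hence Baer over `ℤ` (`Module.Baer.of_divisible`), extend, and the extension of an
  `n`-torsion group lands in the `n`-torsion of `ℝ/ℤ`, which is the image of `ℤ/n`).
* §2 `exists_functional_tateLocalMap_eq_of_integral` — kim3's functional WITHOUT `hsurj`: define
  `(exp*_ω ∘ lift) mod p^{k+1}` on `𝓕_can(v) = im π_{k+1,*}` (well defined by kim3's
  `toZModPow_eq_of_tateLocalMap_eq`, i.e. `ker π_{k+1,*} ⊆ p^{k+1}H¹`), then §1 (`p^k·p` kills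
  `H¹(ℚ_v, E[p^k·p])`, kim3's `pow_zsmul_eq_zero`); and `exists_finLevelFunctional_clauses_of_normalised`
  — for a NORMALISED `φ` (integral, onto `ℤ_p`) with the [BK90] kernel clause `hker`: a family `Λfin` with
  clause (i) of the rider ((Λ)-clauses: onto `ℤ/p^{j+1}` on `𝓕_can(v)`, kernel there = the Kummer
  condition) at EVERY depth — kim3's `lambda_clauses_of_interface` verbatim — and the interface.  Any `p`,
  any place `v`, any row.
* §3 `exists_normalised_of_dual` — from kim3's DISPLAYED duality hypothesis `hdual` (Tate local duality +
  [BK90] Prop. 3.8 in lattice form: `exp*_ω(H¹(ℚ_p, T)) = (log_ω E(ℚ_p))^∨`) at ANY reduction type: the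
  range of `φ` is the lattice `p^{λ₀}ℤ_p` (because `log_ω(E(ℚ_p)) = p^{e}ℤ_p`, n1011's
  `LocalLog.range_padicLog_eq_span_zpow`, every reduction type, `λ₀ = −e`), so `φ = p^{λ₀}·φ′` with `φ′`
  NORMALISED; `hker` transports (`hker_of_eq_zpow_mul`).  NO `Addv`, NO `3 ∤ c₃`, NO `E(ℚ₃)[3] = 0`.
NET for crux 19076: the (Λ)-clauses of the uniform package (C1ᵤ) are KERNEL THEOREMS modulo kim3's two
displayed ℚ₃-level print facts `hker`/`hdual` — the SAME two cite items as crux 19560's Kato stratum.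
References: S. Bloch, K. Kato (1990) §3, Prop. 3.8, Ex. 3.11 [BlochKato1990]; C.-H. Kim, AJM 148 (2026)
§3.2.3, §3.3 (Lemma 3.10–3.11, Prop. 3.12) [Kim2022StructureSelmer]; B. Mazur, K. Rubin, Mem. AMS 799 (2004)
App. A [MazurRubin2004]; J. H. Silverman, *AEC* IV.6.4, VII.6.3 [SilvermanAEC2009]; kim3 memos
KIM3-W2-C1-g11 §2.2, KIM3-W2-C1-SIZING-g12; this seat's HANDOFF (HOME/HANDOFF.md §w2-c3 gen 7).
-/

noncomputable section

-- the cell's Theorems namespace `Summit.BirchSwinnertonDyer.BirchSwinnertonDyer.…` repeats the summit name by design (D-0017)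
set_option linter.dupNamespace false

open scoped Classical NumberField ContRepresentation
open Field NumberField IsDedekindDomain
open WeierstrassCurve Literature.NumberTheory.EllipticCurves Literature.NumberTheory.GaloisRepresentations
  Literature.NumberTheory.GaloisRepresentations.DiscreteGaloisModule
open Summit.BirchSwinnertonDyer.Rank1Residual.GaloisImage
open Summit.BirchSwinnertonDyer.BirchSwinnertonDyer.Theorems.KimAtThreeFineKatoLocalExactness
open Summit.BirchSwinnertonDyer.BirchSwinnertonDyer.Theorems.KimAtThreeFineKatoLemmaL

namespace Summit.BirchSwinnertonDyer.BirchSwinnertonDyer.Theorems.KimAtThreeDeepUpperLocalLatticeUniform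

/-! ### §1. Homomorphisms into `ℤ/n` extend from a subgroup of an `n`-torsion abelian group -/

/-- **Extension of `ℤ/n`-valued homomorphisms** (the self-injectivity of `ℤ/n` on its own modules, via
the divisible group `ℝ/ℤ`): if `n · H = 0`, every homomorphism `F → ℤ/n` on a subgroup `F ≤ H` is the
restriction of a homomorphism `H → ℤ/n`.  Proof: `ℤ/n ↪ ℝ/ℤ` (`j ↦ j/n`), `ℝ/ℤ` is divisible hence
injective over `ℤ` (Baer), extend, and every value of the extension is `n`-torsion in `ℝ/ℤ`, i.e. of the
form `m/n`. [folklore] -/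
theorem exists_addMonoidHom_extend_zmod {H : Type*} [AddCommGroup H] {n : ℕ} [NeZero n]
    (hH : ∀ x : H, n • x = 0) (F : AddSubgroup H) (f : F →+ ZMod n) :
    ∃ g : H →+ ZMod n, ∀ x : F, g x = f x := by
  obtain ⟨G, hG⟩ := (Module.Baer.of_divisible (AddCircle (1 : ℝ))).extension_property_addMonoidHom
    F.subtype F.subtype_injective ((ZMod.toAddCircle (N := n)).comp f)
  have hmem : ∀ x : H, ∃ c : ZMod n, ZMod.toAddCircle c = G x := by
    intro x
    have h0 : n • G x = 0 := by rw [← map_nsmul, hH, map_zero]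
    obtain ⟨m, -, hm⟩ := (AddCircle.nsmul_eq_zero_iff (NeZero.pos n)).mp h0
    refine ⟨(m : ZMod n), ?_⟩
    rw [ZMod.toAddCircle_natCast, ← hm, mul_one]
  choose c hc using hmem
  refine ⟨{ toFun := c, map_zero' := ?_, map_add' := fun x y => ?_ }, fun x => ?_⟩
  · apply ZMod.toAddCircle_injective n
    rw [hc, map_zero, map_zero]
  · apply ZMod.toAddCircle_injective n
    rw [hc, map_add, map_add, hc, hc]
  · apply ZMod.toAddCircle_injective n
    change ZMod.toAddCircle (c (x : H)) = _
    rw [hc]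
    exact DFunLike.congr_fun hG x

/-! ### §2. `Λ_k` with kim3's interface for an integral `exp*_ω`, WITHOUT surjectivity of `π_{k+1,*}` -/

section FiniteLevel

variable (W : WeierstrassCurve ℚ) (p : ℕ) [hp : Fact p.Prime] [W.IsElliptic] (k : ℕ) (v : Place ℚ)
  (φ : (tateLocalRep W p v).cohomology 1 →+ ℚ_[p])

/-- **The finite-level functional at ANY row**: for an integral abstract `exp*_ω = φ` there is
`Λ_k : H¹(ℚ_v, E[p^k·p]) →+ ℤ/p^{k+1}` with `Λ_k(π_{k+1,*} y) = exp*_ω(y) mod p^{k+1}` — NO surjectivity of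
`π_{k+1,*}` (so `E(ℚ_p)[p] ≠ 0` allowed): `(exp*_ω ∘ lift) mod p^{k+1}` is a well-defined homomorphism on
`𝓕_can(v) = im π_{k+1,*}` (kim3's `toZModPow_eq_of_tateLocalMap_eq`) and extends to the whole finite-level
group by §1 (`p^k·p · H¹(ℚ_v, E[p^k·p]) = 0`).
[cite: Kim2022StructureSelmer, §3.3 (Lemma 3.11, Prop. 3.12) and §3.4.1] [cite: MazurRubin2004, App. A, Lemma A.1 and Prop. A.2 (pp. 79–80)] -/
theorem exists_functional_tateLocalMap_eq_of_integral (hint : ∀ y, ‖φ y‖ ≤ 1) :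
    ∃ Λ : galoisCohomology ((W.torsionGaloisModule ((p : ℤ) ^ k * (p : ℤ))).toLocal v) 1 →+
        ZMod (p ^ (k + 1)),
      ∀ (y : (tateLocalRep W p v).cohomology 1) (s : ℤ_[p]), φ y = s →
        Λ (tateLocalMap W p k v y) = PadicInt.toZModPow (k + 1) s := by
  haveI : NeZero (p ^ (k + 1)) := ⟨pow_ne_zero _ hp.out.ne_zero⟩
  set F := propagatedSelmerStructure W p k v with hF
  have hex : ∀ x : F, ∃ y, tateLocalMap W p k v y = (x : _) := fun x =>
    (mem_propagatedSelmerStructure_iff W p k v x.1).mp x.2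
  choose lift hlift using hex
  let ι : (tateLocalRep W p v).cohomology 1 → ℤ_[p] := fun y => ⟨φ y, hint y⟩
  have hι : ∀ y, φ y = ι y := fun y => rfl
  let f₀ : F → ZMod (p ^ (k + 1)) := fun x => PadicInt.toZModPow (k + 1) (ι (lift x))
  have hf₀ : ∀ (x : F) (y : (tateLocalRep W p v).cohomology 1) (s : ℤ_[p]),
      tateLocalMap W p k v y = (x : _) → φ y = s → f₀ x = PadicInt.toZModPow (k + 1) s :=
    fun x y s hy hs => toZModPow_eq_of_tateLocalMap_eq W p k v φ hint (by rw [hlift, hy]) _ _ (hι _) hs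
  let f : F →+ ZMod (p ^ (k + 1)) :=
    { toFun := f₀
      map_zero' := by
        rw [hf₀ 0 0 0 (by rw [map_zero]; rfl) (by rw [map_zero, PadicInt.coe_zero]), map_zero]
      map_add' := fun x x' => by
        have hy : tateLocalMap W p k v (lift x + lift x') = ((x + x' : F) : _) := by
          rw [map_add, hlift, hlift]; rfl
        rw [hf₀ (x + x') (lift x + lift x') (ι (lift x) + ι (lift x')) hy
          (by rw [map_add, PadicInt.coe_add, hι, hι]), map_add] }
  have hH : ∀ x : galoisCohomology ((W.torsionGaloisModule ((p : ℤ) ^ k * (p : ℤ))).toLocal v) 1,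
      (p ^ (k + 1)) • x = 0 := by
    intro x
    rw [← natCast_zsmul, Nat.cast_pow, pow_succ]
    exact pow_zsmul_eq_zero W p k v x
  obtain ⟨g, hg⟩ := exists_addMonoidHom_extend_zmod hH F f
  refine ⟨g, fun y s hs => ?_⟩
  have hmem : tateLocalMap W p k v y ∈ F := (mem_propagatedSelmerStructure_iff W p k v _).mpr ⟨y, rfl⟩
  have h := hg ⟨tateLocalMap W p k v y, hmem⟩
  rw [AddSubgroup.coe_mk] at h
  rw [h]
  exact hf₀ ⟨_, hmem⟩ y s rfl hs

/-- **(Λ)-clauses at EVERY depth from a NORMALISED abstract `exp*_ω`** (`φ` integral and onto `ℤ_p` —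
`φ = p^{-λ₀}·exp*_ω`, §3 — with the [BK90] kernel clause `hker`): a family
`Λfin_j : H¹(ℚ_v, E[p^j·p]) →+ ℤ/p^{j+1}` with, for every `j`, (i-a) onto `ℤ/p^{j+1}` on `𝓕_can(v)`, (i-b)
kernel on `𝓕_can(v)` = the Kummer condition `W.kummerSelmerStructure (p^j·p) v`, AND the interface
`φ(y) = s ∈ ℤ_p ⇒ Λfin_j(π_{j+1,*} y) = s mod p^{j+1}` — kim3's `exists_finLevelFunctional_clauses_three`
with its Kato-stratum binders (`Addv`, `3 ∤ c₃`, `#E(ℚ₃)[3] = 1`) REMOVED: the functional comes from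
`exists_functional_tateLocalMap_eq_of_integral`, the clauses from kim3's `lambda_clauses_of_interface`.
[cite: BlochKato1990, §3 (Prop. 3.8, Ex. 3.11)] [cite: Kim2022StructureSelmer, §3.3 (Lemma 3.11, Prop. 3.12)] -/
theorem exists_finLevelFunctional_clauses_of_normalised (hint : ∀ y, ‖φ y‖ ≤ 1)
    (hsurjφ : ∀ s : ℤ_[p], ∃ y, φ y = s)
    (hker : ∀ y, φ y = 0 ↔
      ∀ j : ℕ, tateLocalMap W p j v y ∈ W.kummerSelmerStructure ((p : ℤ) ^ j * (p : ℤ)) v) :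
    ∃ Λfin : ∀ j : ℕ, galoisCohomology ((W.torsionGaloisModule ((p : ℤ) ^ j * (p : ℤ))).toLocal v) 1 →+
        ZMod (p ^ (j + 1)),
      (∀ j : ℕ,
        (∀ c : ZMod (p ^ (j + 1)), ∃ x ∈ propagatedSelmerStructure W p j v, Λfin j x = c) ∧
        (∀ x ∈ propagatedSelmerStructure W p j v,
          Λfin j x = 0 ↔ x ∈ W.kummerSelmerStructure ((p : ℤ) ^ j * (p : ℤ)) v)) ∧
      (∀ (j : ℕ) (y : (tateLocalRep W p v).cohomology 1) (s : ℤ_[p]), φ y = s →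
        Λfin j (tateLocalMap W p j v y) = PadicInt.toZModPow (j + 1) s) := by
  have hex := fun j => exists_functional_tateLocalMap_eq_of_integral W p j v φ hint
  choose Λ hΛ using hex
  exact ⟨Λ, fun j => lambda_clauses_of_interface W p j v φ hint (hΛ j) hsurjφ hker, fun j y s hs => hΛ j y s hs⟩

end FiniteLevel

/-! ### §3. Normalising a scalar dual exponential that satisfies the lattice-form duality fact, at ANY
reduction type -/

section Normalise

open Summit.BirchSwinnertonDyer.Rank1Residual.Additive.LocalLog

variable (W : WeierstrassCurve ℚ) [W.IsElliptic] [W.IsGloballyMinimal] (p : ℕ) [hp : Fact p.Prime]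
  (v : Place ℚ) (φ : (tateLocalRep W p v).cohomology 1 →+ ℚ_[p])

/-- **The range of a dual-form `exp*_ω` is a rank-one lattice `p^{λ₀}ℤ_p`, at EVERY reduction type.**
From the DISPLAYED duality hypothesis `hdual` of kim3's Lemma L (`a ∈ exp*_ω(H¹) ⟺ ∀ P ∈ E(ℚ_p),
a · log_ω(P) ∈ ℤ_p` — Tate local duality + [BK90] Prop. 3.8 in lattice form) and n1011's
`log_ω(E(ℚ_p)) = p^{e}ℤ_p` (`range_padicLog_eq_span_zpow`, any reduction type, `e = 2 + t − v_p[E(ℚ_p):E⁽²⁾]`):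
`a ∈ range φ ⟺ ‖a · p^e‖ ≤ 1`. [cite: BlochKato1990, §3 (Prop. 3.8, Ex. 3.11)]
[cite: Kim2022StructureSelmer, §3.2.3 (display before Thm. 3.7) and Lemma 3.10] [cite: SilvermanAEC2009, IV.6.4 and VII.6.3] -/
theorem exists_range_iff_norm_mul_zpow_le_of_dual
    (hdual : ∀ a : ℚ_[p], (∃ y, φ y = a) ↔
      ∀ P : (W.baseChange ℚ_[p]).toAffine.Point, ‖a * padicLog (W.baseChange ℚ_[p]) P‖ ≤ 1) :
    ∃ e : ℤ, ∀ a : ℚ_[p], (∃ y, φ y = a) ↔ ‖a * (p : ℚ_[p]) ^ e‖ ≤ 1 := by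
  set e : ℤ := (2 : ℤ) +
      padicValNat p (Nat.card (AddCommGroup.torsion (W.baseChange ℚ_[p]).toAffine.Point)) -
      padicValNat p ((W.baseChange ℚ_[p]).formalFiltration 2).index with he
  have hrange := range_padicLog_eq_span_zpow (W.baseChange ℚ_[p])
  refine ⟨e, fun a => ?_⟩
  rw [hdual a]
  constructor
  · intro h
    have hmem : (p : ℚ_[p]) ^ e ∈ (padicLog (W.baseChange ℚ_[p])).range := by
      rw [hrange, Submodule.mem_toAddSubgroup]
      exact Submodule.mem_span_singleton_self _
    obtain ⟨P, hP⟩ := hmem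
    have h' := h P
    rwa [hP] at h'
  · intro ha P
    have hP : padicLog (W.baseChange ℚ_[p]) P ∈ (padicLog (W.baseChange ℚ_[p])).range := ⟨P, rfl⟩
    rw [hrange, Submodule.mem_toAddSubgroup, Submodule.mem_span_singleton] at hP
    obtain ⟨c, hc⟩ := hP
    rw [← hc, Algebra.smul_def, PadicInt.algebraMap_apply, ← mul_assoc, mul_comm a, mul_assoc, norm_mul]
    exact mul_le_one₀ (PadicInt.norm_le_one c) (norm_nonneg _) ha

/-- **Normalisation at ANY row.** From `hdual` (Tate duality + [BK90] 3.8, lattice form, DISPLAYED) there are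
an integer `λ₀` and a NORMALISED functional `φ′ : H¹(ℚ_v, T_pW) →+ ℚ_p` — integral (`‖φ′ y‖ ≤ 1`) and onto
`ℤ_p` — with `φ = p^{λ₀} · φ′` (`exp*_ω(H¹(ℚ_p, T_pE)) = p^{λ₀}ℤ_p`; on the Kato stratum `λ₀ = 0` and this is
kim3's `lemmaL_range_three`; in general `λ₀ = v_p[E(ℚ_p):E⁽²⁾(ℚ_p)] − 2 − t`, Kim AJM 148 §3.2.3, not needed
explicitly by any consumer of this seat).  NO reduction-type / `c_p` / local-torsion hypothesis.
[cite: BlochKato1990, §3 (Prop. 3.8, Ex. 3.11)] [cite: Kim2022StructureSelmer, §3.2.3 and Lemma 3.10 (PDF pp. 16–17)] -/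
theorem exists_normalised_of_dual
    (hdual : ∀ a : ℚ_[p], (∃ y, φ y = a) ↔
      ∀ P : (W.baseChange ℚ_[p]).toAffine.Point, ‖a * padicLog (W.baseChange ℚ_[p]) P‖ ≤ 1) :
    ∃ (φ' : (tateLocalRep W p v).cohomology 1 →+ ℚ_[p]) (lam : ℤ),
      (∀ y, ‖φ' y‖ ≤ 1) ∧ (∀ s : ℤ_[p], ∃ y, φ' y = s) ∧
      (∀ y, φ y = (p : ℚ_[p]) ^ lam * φ' y) := by
  obtain ⟨e, he⟩ := exists_range_iff_norm_mul_zpow_le_of_dual W p v φ hdual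
  have hp0 : (p : ℚ_[p]) ≠ 0 := Nat.cast_ne_zero.mpr hp.out.ne_zero
  have hpe : (p : ℚ_[p]) ^ e ≠ 0 := zpow_ne_zero e hp0
  refine ⟨(AddMonoidHom.mulLeft ((p : ℚ_[p]) ^ e)).comp φ, -e, fun y => ?_, fun s => ?_, fun y => ?_⟩
  · rw [AddMonoidHom.comp_apply, AddMonoidHom.coe_mulLeft, mul_comm]
    exact (he (φ y)).mp ⟨y, rfl⟩
  · obtain ⟨y, hy⟩ := (he ((s : ℚ_[p]) * ((p : ℚ_[p]) ^ e)⁻¹)).mpr (by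
      rw [inv_mul_cancel_right₀ hpe]; exact PadicInt.norm_le_one s)
    refine ⟨y, ?_⟩
    rw [AddMonoidHom.comp_apply, AddMonoidHom.coe_mulLeft, hy, mul_comm, inv_mul_cancel_right₀ hpe]
  · rw [AddMonoidHom.comp_apply, AddMonoidHom.coe_mulLeft, ← mul_assoc, zpow_neg, inv_mul_cancel₀ hpe,
      one_mul]

omit [W.IsGloballyMinimal] in
/-- The [BK90] kernel clause `hker` transports along `φ = c · φ′`, `c ≠ 0`. [folklore] -/
theorem hker_of_eq_mul {φ' : (tateLocalRep W p v).cohomology 1 →+ ℚ_[p]} {c : ℚ_[p]} (hc : c ≠ 0)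
    (hφ : ∀ y, φ y = c * φ' y)
    (hker : ∀ y, φ y = 0 ↔
      ∀ j : ℕ, tateLocalMap W p j v y ∈ W.kummerSelmerStructure ((p : ℤ) ^ j * (p : ℤ)) v) :
    ∀ y, φ' y = 0 ↔
      ∀ j : ℕ, tateLocalMap W p j v y ∈ W.kummerSelmerStructure ((p : ℤ) ^ j * (p : ℤ)) v := by
  intro y
  rw [← hker y, hφ y, mul_eq_zero, or_iff_right hc]

/-- **§2 + §3 at ANY row: the (Λ)-clauses and the SCALED interface from kim3's two displayed ℚ_p-level
print facts alone.**  For `W/ℚ` globally minimal, ANY place `v` (intended `v ∣ p`), and an abstract scalar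
dual exponential `φ = exp*_ω` with `hker` ([BK90] 3.8/3.11: kernel = `H¹_f`) and `hdual` (Tate duality +
[BK90] 3.8: range = `(log_ω E(ℚ_p))^∨`): an integer `λ₀`, a normalised `φ′` with `φ = p^{λ₀}φ′`, and a family
`Λfin_j` with clause (i) at every depth and the interface for `φ′`.  NO `Addv`, `c_p`, torsion hypothesis.
[cite: BlochKato1990, §3 (Prop. 3.8, Ex. 3.11)] [cite: Kim2022StructureSelmer, §3.2.3, §3.3 (Lemma 3.10–3.11, Prop. 3.12)]
[cite: MazurRubin2004, App. A, Prop. A.2 (pp. 79–80)] -/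
theorem exists_finLevelFunctional_clauses_of_dual
    (hker : ∀ y, φ y = 0 ↔
      ∀ j : ℕ, tateLocalMap W p j v y ∈ W.kummerSelmerStructure ((p : ℤ) ^ j * (p : ℤ)) v)
    (hdual : ∀ a : ℚ_[p], (∃ y, φ y = a) ↔
      ∀ P : (W.baseChange ℚ_[p]).toAffine.Point, ‖a * padicLog (W.baseChange ℚ_[p]) P‖ ≤ 1) :
    ∃ (φ' : (tateLocalRep W p v).cohomology 1 →+ ℚ_[p]) (lam : ℤ)
      (Λfin : ∀ j : ℕ, galoisCohomology ((W.torsionGaloisModule ((p : ℤ) ^ j * (p : ℤ))).toLocal v) 1 →+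
        ZMod (p ^ (j + 1))),
      (∀ y, ‖φ' y‖ ≤ 1) ∧ (∀ y, φ y = (p : ℚ_[p]) ^ lam * φ' y) ∧
      (∀ j : ℕ,
        (∀ c : ZMod (p ^ (j + 1)), ∃ x ∈ propagatedSelmerStructure W p j v, Λfin j x = c) ∧
        (∀ x ∈ propagatedSelmerStructure W p j v,
          Λfin j x = 0 ↔ x ∈ W.kummerSelmerStructure ((p : ℤ) ^ j * (p : ℤ)) v)) ∧
      (∀ (j : ℕ) (y : (tateLocalRep W p v).cohomology 1) (s : ℤ_[p]), φ' y = s →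
        Λfin j (tateLocalMap W p j v y) = PadicInt.toZModPow (j + 1) s) := by
  obtain ⟨φ', lam, hint, hsurj, hφ⟩ := exists_normalised_of_dual W p v φ hdual
  have hc : (p : ℚ_[p]) ^ lam ≠ 0 := zpow_ne_zero lam (Nat.cast_ne_zero.mpr hp.out.ne_zero)
  have hker' := hker_of_eq_mul W p v φ hc hφ hker
  obtain ⟨Λfin, hΛ, hI⟩ := exists_finLevelFunctional_clauses_of_normalised W p v φ' hint hsurj hker'
  exact ⟨φ', lam, Λfin, hint, hφ, hΛ, hI⟩

end Normalise

end Summit.BirchSwinnertonDyer.BirchSwinnertonDyer.Theorems.KimAtThreeDeepUpperLocalLatticeUniform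

end
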